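import Literature.NumberTheory.LFunctions.LargeValuesFourierDecay
import Literature.NumberTheory.LFunctions.LargeValuesTraceMethod
import Mathlib.Analysis.MeanInequalitiesPow
import HarnessLib

/-!
# The trace expansion: Guth–Maynard Lemmas 4.4, 4.5, Proposition 4.6 and Proposition 5.1

Topic `NumberTheory/LFunctions`, family RH. Continuation of `LargeValuesTraceMethod.lean`
(Lemmas 4.1–4.2: large values are controlled by `tr(G)` and `tr(G³)` for the Gram matrix
`G_{t₁,t₂} = ∑_n w(n/N)² n^{i(t₁−t₂)}`) and `LargeValuesFourierDecay.lean` (Lemma 4.3 and Poisson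
summation for the entries of `G`) in the programme reducing the named fact
`Literature.NumberTheory.LFunctions.zeroDensity_guth_maynard` to Proposition 3.1 of
L. Guth, J. Maynard, *New large value estimates for Dirichlet polynomials*, Ann. of Math. 203 (2026)
(`zeroDensity_guth_maynard_of_keyProp`). This file PROVES, for an arbitrary smooth weight `w`
supported in `[1,2]`:

* **Lemma 4.4 (Hilbert–Schmidt norm)**, exact form `tr(G) = |W|·N·(A(0) + B_N(0))` with
  `A(0) = ĥ_0(0) = ‖w‖²_{L²}` and `|B_N(0)| = |∑_{m≠0} ĥ_0(mN)| ≪_j N^{-j}` (`trace_gram`, `coefA_zero`,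
  `norm_coefB_le`);
* **Lemma 4.5 (Expansion of the cubic trace)**, exact form
  `tr(G³) = N³ ∑_{t₁,t₂,t₃∈W} ∏ (A + B_N)(t_a − t_b) = S₀ + S₁ + S₂ + S₃` (`trace_gram_pow_three`), where
  `A(τ) = ĥ_τ(0)`, `B_N(τ) = ∑_{m≠0} ĥ_τ(mN)` and `S_k` collects the terms `I_m` with exactly `k`
  non-zero `m_i` (eq. (5.5) of the paper; `S₀ = I_0`), together with
  `S₀ = N³|W|ĥ_0(0)³ + O_j(N³|W|³δ^{-j})` for `δ`-separated `W` (`norm_S0_sub_le`);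
* **Proposition 5.1 (`S₁` bound)** in the quantitative form
  `|S₁| ≪_j N³|W|³((1+L)²δ^{-j} + N^{-j})` for `δ`-separated `W` of diameter `≤ L` (`norm_S1_le`);
* **Proposition 4.6**: `|W| ≤ C (N^{2−2σ} + N^{1−2σ}|S₂ + S₃|^{1/3} + N^{1−2σ} R^{1/3})` whenever
  `|∑_n w(n/N) b_n n^{it}| ≥ N^σ` on `W` with `|b_n| ≤ 1` (`card_le_of_largeValues`, with the explicit
  error budget `R = errR w N W`), and its form in the setting of Proposition 3.1 (`W` in an interval
  of length `T = N^{6/5}`, `T^ε`-separated), where `R ≪ 1` and `S₁` is negligible: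
  `|W| ≤ C (N^{2−2σ} + N^{1−2σ}|S₂ + S₃|^{1/3})` (`card_le_keyProp_setting`).

Thus Proposition 3.1 (hypothesis `hKP` of `zeroDensity_guth_maynard_of_keyProp`) is reduced to the
bounds for `S₂` (§6 of the paper, via Heath-Brown's theorem) and `S₃` (§§7–11), which are not in
the tree. Definitions (with bodies; no named fact is introduced, everything here is proved):
`coefA`, `coefB`, `gram`, `S0`, `S1`, `S2`, `S3`, `errR`.

## References

* L. Guth, J. Maynard, *New large value estimates for Dirichlet polynomials*, Ann. of Math. (2)
  203 (2026), no. 2; arXiv:2405.20552 (2024): §4 (Lemmas 4.4, 4.5, Proposition 4.6), §5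
  (eqs. (5.1)–(5.5), Proposition 5.1).
-/

noncomputable section

open Real Set Filter Topology Complex MeasureTheory Finset
open scoped FourierTransform ContDiff

namespace Literature.NumberTheory.LFunctions

namespace GuthMaynardFourier

/-! ## §7. The coefficients `A(τ) = ĥ_τ(0)`, `B_N(τ) = ∑_{m ≠ 0} ĥ_τ(Nm)` and the Gram matrix -/

/-- `A(τ) := ĥ_τ(0) = ∫ w(u)² u^{iτ} du` (the `m = 0` Poisson term). [cite: GuthMaynard2026, Lemma 4.5] -/
def coefA (w : ℝ → ℝ) (τ : ℝ) : ℂ := 𝓕 (hFun w τ) 0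

/-- `B_N(τ) := ∑_{m ∈ ℤ, m ≠ 0} ĥ_τ(Nm)` (the Poisson terms with `m ≠ 0`).
[cite: GuthMaynard2026, Lemma 4.5] -/
def coefB (w : ℝ → ℝ) (N : ℝ) (τ : ℝ) : ℂ := ∑' m : ℤ, if m = 0 then 0 else 𝓕 (hFun w τ) (N * m)

/-- The Gram matrix `G = M_W M_W^*`, `G_{t',t} = ∑_{N ≤ n ≤ 2N} w(n/N)² n^{i(t'−t)}` on a finite set
`W ⊂ ℝ` (as in `GuthMaynardMatrix.card_mul_sq_le_traceBound` with `ω_n = w(n/N)`).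
[cite: GuthMaynard2026, Section 4] -/
def gram (w : ℝ → ℝ) (N : ℕ) (W : Finset ℝ) : Matrix W W ℂ :=
  Matrix.of fun t' t : W ↦ ∑ n ∈ Finset.Icc N (2 * N),
    (((w ((n : ℝ) / N)) ^ 2 : ℝ) : ℂ) * (n : ℂ) ^ ((((t' : ℝ) - (t : ℝ) : ℝ) : ℂ) * I)

/-- `S₀ := N³ ∑_{t₁,t₂,t₃ ∈ W} A(t₁−t₂)A(t₂−t₃)A(t₃−t₁)` (the terms `I_m` with `m = 0`).
[cite: GuthMaynard2026, Lemma 4.5, `I_0`] -/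
def S0 (w : ℝ → ℝ) (N : ℕ) (W : Finset ℝ) : ℂ :=
  (N : ℂ) ^ 3 * ∑ t₁ ∈ W, ∑ t₂ ∈ W, ∑ t₃ ∈ W,
    coefA w (t₁ - t₂) * coefA w (t₂ - t₃) * coefA w (t₃ - t₁)

/-- `S₁`: the terms `I_m` where exactly one `m_i` is non-zero,
`S₁ = N³ ∑_{t₁,t₂,t₃} (B A A + A B A + A A B)`. [cite: GuthMaynard2026, (5.5)] -/
def S1 (w : ℝ → ℝ) (N : ℕ) (W : Finset ℝ) : ℂ :=
  (N : ℂ) ^ 3 * ∑ t₁ ∈ W, ∑ t₂ ∈ W, ∑ t₃ ∈ W,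
    (coefB w N (t₁ - t₂) * coefA w (t₂ - t₃) * coefA w (t₃ - t₁) +
      coefA w (t₁ - t₂) * coefB w N (t₂ - t₃) * coefA w (t₃ - t₁) +
      coefA w (t₁ - t₂) * coefA w (t₂ - t₃) * coefB w N (t₃ - t₁))

/-- `S₂`: the terms `I_m` where exactly two `m_i` are non-zero,
`S₂ = N³ ∑_{t₁,t₂,t₃} (B B A + B A B + A B B)`. [cite: GuthMaynard2026, (5.5)] -/
def S2 (w : ℝ → ℝ) (N : ℕ) (W : Finset ℝ) : ℂ :=
  (N : ℂ) ^ 3 * ∑ t₁ ∈ W, ∑ t₂ ∈ W, ∑ t₃ ∈ W,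
    (coefB w N (t₁ - t₂) * coefB w N (t₂ - t₃) * coefA w (t₃ - t₁) +
      coefB w N (t₁ - t₂) * coefA w (t₂ - t₃) * coefB w N (t₃ - t₁) +
      coefA w (t₁ - t₂) * coefB w N (t₂ - t₃) * coefB w N (t₃ - t₁))

/-- `S₃`: the terms `I_m` where all three `m_i` are non-zero, `S₃ = N³ ∑_{t₁,t₂,t₃} B B B`.
[cite: GuthMaynard2026, (5.5)] -/
def S3 (w : ℝ → ℝ) (N : ℕ) (W : Finset ℝ) : ℂ :=
  (N : ℂ) ^ 3 * ∑ t₁ ∈ W, ∑ t₂ ∈ W, ∑ t₃ ∈ W,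
    coefB w N (t₁ - t₂) * coefB w N (t₂ - t₃) * coefB w N (t₃ - t₁)

section weight

variable {w : ℝ → ℝ}

/-- `A(τ) + B_N(τ) = ∑_{m ∈ ℤ} ĥ_τ(Nm)`. [cite: GuthMaynard2026, proof of Lemma 4.5] -/
theorem coefA_add_coefB (hw : ContDiff ℝ ∞ w) (hsupp : Function.support w ⊆ Set.Icc 1 2) (τ : ℝ)
    {N : ℝ} (hN : 0 < N) : coefA w τ + coefB w N τ = ∑' m : ℤ, 𝓕 (hFun w τ) (N * m) := by
  classical
  rw [(summable_fourier_hFun hw hsupp τ hN).tsum_eq_add_tsum_ite 0]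
  simp [coefA, coefB]

/-- `A(0) = ĥ_0(0) = ∫ w² = ‖w‖_{L²}²`. [cite: GuthMaynard2026, proof of Lemma 4.4] -/
theorem coefA_zero (w : ℝ → ℝ) : coefA w 0 = ((∫ u, (w u) ^ 2 : ℝ) : ℂ) := by
  rw [coefA, Real.fourier_real_eq]
  simp only [mul_zero, neg_zero, AddChar.map_zero_eq_one, one_smul]
  have : ∀ v, hFun w 0 v = (((w v) ^ 2 : ℝ) : ℂ) := fun v ↦ by simp [hFun, ePow]
  simp_rw [this]
  exact integral_ofReal

/-- `|A(τ)| ≪ 1`. [cite: GuthMaynard2026, Lemma 4.3] -/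
theorem norm_coefA_le (hw : ContDiff ℝ ∞ w) (hsupp : Function.support w ⊆ Set.Icc 1 2) :
    ∃ C, 0 ≤ C ∧ ∀ τ, ‖coefA w τ‖ ≤ C := by
  obtain ⟨C, hC0, hC⟩ := norm_fourier_hFun_le hw hsupp
  exact ⟨C, hC0, fun τ ↦ hC τ 0⟩

/-- `|A(τ)| = |ĥ_τ(0)| ≪_j |τ|^{-j}` for `τ ≠ 0` (Lemma 4.3, second bound, at `ξ = 0`); in
particular `|ĥ_{t₁−t₂}(0)| ≪_ε T^{-100}` for `T^ε`-separated `t₁ ≠ t₂`, eq. (5.1) of the paper.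
[cite: GuthMaynard2026, Lemma 4.3 and (5.1)] -/
theorem norm_coefA_le_div (hw : ContDiff ℝ ∞ w) (hsupp : Function.support w ⊆ Set.Icc 1 2)
    (j : ℕ) : ∃ C, 0 ≤ C ∧ ∀ τ, τ ≠ 0 → ‖coefA w τ‖ ≤ C / |τ| ^ j := by
  obtain ⟨C, hC0, hC⟩ := norm_fourier_hFun_le_pow_div' hw hsupp j
  refine ⟨C, hC0, fun τ hτ ↦ ?_⟩
  have := hC τ 0 hτ
  rw [coefA]
  simpa using this

/-- `|B_N(τ)| ≪_j (1+|τ|)^j N^{-j}` for `j ≥ 2`, `N ≥ 1` (Lemma 4.3, first bound, summed over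
`m ≠ 0`); in particular `|∑_{m≠0} ĥ_0(mN)| ≪ N^{-100}`, eq. (5.3) of the paper.
[cite: GuthMaynard2026, Lemma 4.3, proof of Lemma 4.4 and (5.3)] -/
theorem norm_coefB_le (hw : ContDiff ℝ ∞ w) (hsupp : Function.support w ⊆ Set.Icc 1 2) {j : ℕ}
    (hj : 2 ≤ j) : ∃ C, 0 ≤ C ∧ ∀ τ N : ℝ, 1 ≤ N → ‖coefB w N τ‖ ≤ C * (1 + |τ|) ^ j / N ^ j := by
  obtain ⟨C, hC0, hC⟩ := norm_fourier_hFun_le_pow_div hw hsupp j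
  have hZs := Real.summable_abs_int_rpow one_lt_two
  set Z : ℝ := ∑' m : ℤ, |(m : ℝ)| ^ (-(2 : ℝ)) with hZ
  have hZ0 : 0 ≤ Z := tsum_nonneg fun m ↦ Real.rpow_nonneg (abs_nonneg _) _
  refine ⟨C * Z, by positivity, fun τ N hN ↦ ?_⟩
  have hN0 : 0 < N := by linarith
  rw [coefB]
  have hmain : ‖∑' m : ℤ, (if m = 0 then (0 : ℂ) else 𝓕 (hFun w τ) (N * m))‖ ≤
      C * (1 + |τ|) ^ j / N ^ j * Z := by
    refine tsum_of_norm_bounded (hZs.hasSum.mul_left (C * (1 + |τ|) ^ j / N ^ j)) fun m ↦ ?_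
    split_ifs with hm
    · rw [norm_zero]; positivity
    · have hm1 : 1 ≤ |(m : ℝ)| := by
        rw [← Int.cast_abs]; exact_mod_cast Int.one_le_abs hm
      have hm0 : 0 < |(m : ℝ)| := by linarith
      have h1 := hC τ (N * m) (mul_ne_zero hN0.ne' (by exact_mod_cast hm))
      rw [abs_mul, abs_of_pos hN0, mul_pow] at h1
      refine h1.trans ?_
      rw [Real.rpow_neg (abs_nonneg _), show (2 : ℝ) = (2 : ℕ) by norm_num, Real.rpow_natCast]
      have h2 : |(m : ℝ)| ^ 2 ≤ |(m : ℝ)| ^ j := pow_le_pow_right₀ hm1 hj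
      have h3 : C * (1 + |τ|) ^ j / (N ^ j * |(m : ℝ)| ^ j) ≤
          C * (1 + |τ|) ^ j / (N ^ j * |(m : ℝ)| ^ 2) :=
        div_le_div_of_nonneg_left (by positivity) (by positivity) (by gcongr)
      refine h3.trans (le_of_eq ?_)
      field_simp
  calc _ ≤ C * (1 + |τ|) ^ j / N ^ j * Z := hmain
    _ = C * Z * (1 + |τ|) ^ j / N ^ j := by ring

/-- **Guth–Maynard Lemma 4.4 (Hilbert–Schmidt norm), exact form**:
`tr(M_W M_W^*) = |W| · N · (A(0) + B_N(0))` with `A(0) = ‖w‖_{L²}²` and `|B_N(0)| ≪_j N^{-j}`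
(`coefA_zero`, `norm_coefB_le`), i.e. `tr(M_WM_W^*) = N|W|‖w‖²_{L²} + O(|W| N^{1-j})`.
[cite: GuthMaynard2026, Lemma 4.4] -/
theorem trace_gram (hw : ContDiff ℝ ∞ w) (hsupp : Function.support w ⊆ Set.Icc 1 2) {N : ℕ}
    (hN : 1 ≤ N) (W : Finset ℝ) :
    (gram w N W).trace = (W.card : ℂ) * ((N : ℂ) * (coefA w 0 + coefB w N 0)) := by
  have hN0 : (0 : ℝ) < N := by exact_mod_cast hN
  unfold Matrix.trace gram
  simp only [Matrix.diag_apply, Matrix.of_apply, sub_self, Complex.ofReal_zero, zero_mul,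
    Complex.cpow_zero, mul_one]
  rw [Finset.sum_const, Finset.card_univ, Fintype.card_coe, nsmul_eq_mul]
  congr 1
  have h := sum_weight_sq_cpow_eq hw hsupp hN 0
  simp only [Complex.ofReal_zero, zero_mul, Complex.cpow_zero, mul_one, one_mul] at h
  rw [h, ← coefA_add_coefB hw hsupp 0 hN0]

/-- `N^{iτ₁} N^{iτ₂} N^{iτ₃} = 1` when `τ₁ + τ₂ + τ₃ = 0`. [folklore] -/
theorem cpow_cycle_eq_one {N : ℕ} (hN : 1 ≤ N) (t₁ t₂ t₃ : ℝ) :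
    (N : ℂ) ^ (((t₁ - t₂ : ℝ) : ℂ) * I) * (N : ℂ) ^ (((t₂ - t₃ : ℝ) : ℂ) * I) *
      (N : ℂ) ^ (((t₃ - t₁ : ℝ) : ℂ) * I) = 1 := by
  have hN0 : (N : ℂ) ≠ 0 := by exact_mod_cast (show N ≠ 0 by omega)
  rw [← Complex.cpow_add _ _ hN0, ← Complex.cpow_add _ _ hN0]
  have : ((t₁ - t₂ : ℝ) : ℂ) * I + ((t₂ - t₃ : ℝ) : ℂ) * I + ((t₃ - t₁ : ℝ) : ℂ) * I = 0 := by
    push_cast; ring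
  rw [this, Complex.cpow_zero]

/-- `tr(G³) = ∑_{t₁,t₂,t₃} G_{t₁t₂} G_{t₂t₃} G_{t₃t₁}` for `G_{ab} = P(a − b)`. [folklore] -/
theorem trace_pow_three_eq {W : Finset ℝ} (P : ℝ → ℂ) (G : Matrix W W ℂ)
    (hG : ∀ a b : W, G a b = P ((a : ℝ) - (b : ℝ))) :
    (G ^ 3).trace = ∑ t₁ ∈ W, ∑ t₂ ∈ W, ∑ t₃ ∈ W, P (t₁ - t₂) * P (t₂ - t₃) * P (t₃ - t₁) := by
  rw [pow_three', Matrix.trace]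
  simp only [Matrix.diag_apply, Matrix.mul_apply, hG, Finset.sum_mul]
  rw [← Finset.sum_coe_sort W]
  refine Finset.sum_congr rfl fun i _ ↦ ?_
  rw [Finset.sum_comm, ← Finset.sum_coe_sort W]
  refine Finset.sum_congr rfl fun j _ ↦ ?_
  rw [← Finset.sum_coe_sort W]

/-- **Guth–Maynard Lemma 4.5 (Expansion of the cubic trace), exact form**: expanding the trace and
applying Poisson summation in `n₁, n₂, n₃`,
`tr((M_WM_W^*)³) = N³ ∑_{t₁,t₂,t₃} ∏ (A + B_N)(t_a − t_b) = S₀ + S₁ + S₂ + S₃`, where `S₀` collects the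
terms with `m = 0` and `S₁, S₂, S₃` those with exactly one, two, three non-zero `m_i` (eq. (5.5)).
[cite: GuthMaynard2026, Lemma 4.5 and (5.5)] -/
theorem trace_gram_pow_three (hw : ContDiff ℝ ∞ w) (hsupp : Function.support w ⊆ Set.Icc 1 2)
    {N : ℕ} (hN : 1 ≤ N) (W : Finset ℝ) :
    ((gram w N W) ^ 3).trace = S0 w N W + S1 w N W + S2 w N W + S3 w N W := by
  have hN0 : (0 : ℝ) < N := by exact_mod_cast hN
  -- the entries after Poisson summation
  set P : ℝ → ℂ := fun τ ↦ ∑ n ∈ Finset.Icc N (2 * N), (((w ((n : ℝ) / N)) ^ 2 : ℝ) : ℂ) *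
      (n : ℂ) ^ ((τ : ℂ) * I) with hPdef
  have hP : ∀ τ : ℝ, P τ = (N : ℂ) ^ ((τ : ℂ) * I) * N * (coefA w τ + coefB w N τ) := by
    intro τ
    rw [hPdef]
    simp only
    rw [sum_weight_sq_cpow_eq hw hsupp hN τ, coefA_add_coefB hw hsupp τ hN0]
  have htr := trace_pow_three_eq P (gram w N W) (fun a b ↦ by rw [hPdef, gram, Matrix.of_apply])
  rw [htr]
  -- substitute and use `N^{iτ₁}N^{iτ₂}N^{iτ₃} = 1`
  have hterm : ∀ t₁ t₂ t₃ : ℝ, P (t₁ - t₂) * P (t₂ - t₃) * P (t₃ - t₁) =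
      (N : ℂ) ^ 3 * ((coefA w (t₁ - t₂) + coefB w N (t₁ - t₂)) *
        (coefA w (t₂ - t₃) + coefB w N (t₂ - t₃)) * (coefA w (t₃ - t₁) + coefB w N (t₃ - t₁))) := by
    intro t₁ t₂ t₃
    rw [hP, hP, hP]
    have h1 := cpow_cycle_eq_one hN t₁ t₂ t₃
    calc (N : ℂ) ^ (((t₁ - t₂ : ℝ) : ℂ) * I) * N * (coefA w (t₁ - t₂) + coefB w N (t₁ - t₂)) *
          ((N : ℂ) ^ (((t₂ - t₃ : ℝ) : ℂ) * I) * N * (coefA w (t₂ - t₃) + coefB w N (t₂ - t₃))) *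
          ((N : ℂ) ^ (((t₃ - t₁ : ℝ) : ℂ) * I) * N * (coefA w (t₃ - t₁) + coefB w N (t₃ - t₁)))
        = ((N : ℂ) ^ (((t₁ - t₂ : ℝ) : ℂ) * I) * (N : ℂ) ^ (((t₂ - t₃ : ℝ) : ℂ) * I) *
            (N : ℂ) ^ (((t₃ - t₁ : ℝ) : ℂ) * I)) * ((N : ℂ) ^ 3 *
            ((coefA w (t₁ - t₂) + coefB w N (t₁ - t₂)) *
            (coefA w (t₂ - t₃) + coefB w N (t₂ - t₃)) *
            (coefA w (t₃ - t₁) + coefB w N (t₃ - t₁)))) := by ring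
      _ = _ := by rw [h1, one_mul]
  simp_rw [hterm]
  rw [S0, S1, S2, S3]
  simp only [Finset.mul_sum]
  simp only [← Finset.sum_add_distrib]
  refine Finset.sum_congr rfl fun t₁ _ ↦ Finset.sum_congr rfl fun t₂ _ ↦
    Finset.sum_congr rfl fun t₃ _ ↦ ?_
  ring

end weight

/-! ## §8. The error terms: `S₀ − N³|W|‖w‖⁶_{L²}` (Lemma 4.5) and `S₁` (Proposition 5.1) -/

/-- Norm of a triple sum over `W³` with uniformly bounded terms. [folklore] -/
theorem norm_triple_sum_le {W : Finset ℝ} {g : ℝ → ℝ → ℝ → ℂ} {K : ℝ}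
    (hK : ∀ t₁ ∈ W, ∀ t₂ ∈ W, ∀ t₃ ∈ W, ‖g t₁ t₂ t₃‖ ≤ K) :
    ‖∑ t₁ ∈ W, ∑ t₂ ∈ W, ∑ t₃ ∈ W, g t₁ t₂ t₃‖ ≤ (W.card : ℝ) ^ 3 * K := by
  calc ‖∑ t₁ ∈ W, ∑ t₂ ∈ W, ∑ t₃ ∈ W, g t₁ t₂ t₃‖
      ≤ ∑ t₁ ∈ W, ‖∑ t₂ ∈ W, ∑ t₃ ∈ W, g t₁ t₂ t₃‖ := norm_sum_le _ _
    _ ≤ ∑ t₁ ∈ W, ∑ t₂ ∈ W, ‖∑ t₃ ∈ W, g t₁ t₂ t₃‖ :=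
        Finset.sum_le_sum fun _ _ ↦ norm_sum_le _ _
    _ ≤ ∑ t₁ ∈ W, ∑ t₂ ∈ W, ∑ t₃ ∈ W, ‖g t₁ t₂ t₃‖ :=
        Finset.sum_le_sum fun _ _ ↦ Finset.sum_le_sum fun _ _ ↦ norm_sum_le _ _
    _ ≤ ∑ t₁ ∈ W, ∑ t₂ ∈ W, ∑ t₃ ∈ W, K :=
        Finset.sum_le_sum fun t₁ h₁ ↦ Finset.sum_le_sum fun t₂ h₂ ↦
          Finset.sum_le_sum fun t₃ h₃ ↦ hK t₁ h₁ t₂ h₂ t₃ h₃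
    _ = (W.card : ℝ) ^ 3 * K := by
        simp only [Finset.sum_const, nsmul_eq_mul]; ring

/-- Splitting off the diagonal `t₁ = t₂ = t₃` of a triple sum over `W³`. [folklore] -/
theorem triple_sum_eq_diag_add {W : Finset ℝ} (f : ℝ → ℝ → ℝ → ℂ) [DecidableEq ℝ] :
    ∑ t₁ ∈ W, ∑ t₂ ∈ W, ∑ t₃ ∈ W, f t₁ t₂ t₃ = ∑ t₁ ∈ W, f t₁ t₁ t₁ +
      ∑ t₁ ∈ W, ∑ t₂ ∈ W, ∑ t₃ ∈ W, (if t₂ = t₁ ∧ t₃ = t₁ then 0 else f t₁ t₂ t₃) := by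
  have hdiag : ∀ t₁ ∈ W, f t₁ t₁ t₁ =
      ∑ t₂ ∈ W, ∑ t₃ ∈ W, (if t₂ = t₁ ∧ t₃ = t₁ then f t₁ t₂ t₃ else 0) := by
    intro t₁ ht₁
    rw [Finset.sum_eq_single_of_mem t₁ ht₁ (fun t₂ _ ht₂ ↦ by simp [ht₂])]
    rw [Finset.sum_eq_single_of_mem t₁ ht₁ (fun t₃ _ ht₃ ↦ by simp [ht₃])]
    simp
  rw [Finset.sum_congr rfl hdiag, ← Finset.sum_add_distrib]
  refine Finset.sum_congr rfl fun t₁ _ ↦ ?_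
  rw [← Finset.sum_add_distrib]
  refine Finset.sum_congr rfl fun t₂ _ ↦ ?_
  rw [← Finset.sum_add_distrib]
  refine Finset.sum_congr rfl fun t₃ _ ↦ ?_
  split_ifs <;> simp

section weight

variable {w : ℝ → ℝ}

/-- **The `m = 0` terms (Lemma 4.5)**: for a `δ`-separated `W`,
`S₀ = N³|W| ĥ_0(0)³ + O_j(N³|W|³δ^{-j})`: off the diagonal `t₁ = t₂ = t₃` one factor is
`ĥ_{t_a−t_b}(0)` with `t_a ≠ t_b`, which is `≪_j |t_a − t_b|^{-j} ≤ δ^{-j}` ("Since `W` is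
`T^ε`-separated, `ĥ_{t₁−t₂}(0) ≪_ε T^{-200}` if `t₁ ≠ t₂` … and so
`I_0 = N³|W|‖w‖⁶_{L²} + O_ε(T^{-100})`"). [cite: GuthMaynard2026, Lemma 4.5 (proof)] -/
theorem norm_S0_sub_le (hw : ContDiff ℝ ∞ w) (hsupp : Function.support w ⊆ Set.Icc 1 2) (j : ℕ) :
    ∃ C, 0 ≤ C ∧ ∀ (N : ℕ) (W : Finset ℝ) (δ : ℝ), 0 < δ →
      (∀ t ∈ W, ∀ t' ∈ W, t ≠ t' → δ ≤ |t - t'|) →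
      ‖S0 w N W - (N : ℂ) ^ 3 * W.card * (coefA w 0) ^ 3‖ ≤
        C * (N : ℝ) ^ 3 * (W.card : ℝ) ^ 3 / δ ^ j := by
  obtain ⟨C₀, hC₀0, hC₀⟩ := norm_coefA_le hw hsupp
  obtain ⟨C₁, hC₁0, hC₁⟩ := norm_coefA_le_div hw hsupp j
  refine ⟨C₀ ^ 2 * C₁, by positivity, fun N W δ hδ hsep ↦ ?_⟩
  classical
  have hA : ∀ t ∈ W, ∀ t' ∈ W, t ≠ t' → ‖coefA w (t - t')‖ ≤ C₁ / δ ^ j := by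
    intro t ht t' ht' hne
    have hτ : t - t' ≠ 0 := sub_ne_zero.mpr hne
    refine (hC₁ _ hτ).trans ?_
    exact div_le_div_of_nonneg_left hC₁0 (pow_pos hδ j)
      (pow_le_pow_left₀ hδ.le (hsep t ht t' ht' hne) j)
  set f : ℝ → ℝ → ℝ → ℂ := fun t₁ t₂ t₃ ↦
    coefA w (t₁ - t₂) * coefA w (t₂ - t₃) * coefA w (t₃ - t₁) with hf
  have hsplit := triple_sum_eq_diag_add (W := W) f
  have hdiag : ∑ t₁ ∈ W, f t₁ t₁ t₁ = W.card * (coefA w 0) ^ 3 := by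
    simp only [hf, sub_self, Finset.sum_const, nsmul_eq_mul]; ring
  have hS0 : S0 w N W - (N : ℂ) ^ 3 * W.card * (coefA w 0) ^ 3 = (N : ℂ) ^ 3 *
      ∑ t₁ ∈ W, ∑ t₂ ∈ W, ∑ t₃ ∈ W, (if t₂ = t₁ ∧ t₃ = t₁ then 0 else f t₁ t₂ t₃) := by
    rw [S0]
    change (N : ℂ) ^ 3 * ∑ t₁ ∈ W, ∑ t₂ ∈ W, ∑ t₃ ∈ W, f t₁ t₂ t₃ - _ = _
    rw [hsplit, hdiag]; ring
  rw [hS0, norm_mul, norm_pow, Complex.norm_natCast]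
  have hbound : ∀ t₁ ∈ W, ∀ t₂ ∈ W, ∀ t₃ ∈ W,
      ‖(if t₂ = t₁ ∧ t₃ = t₁ then 0 else f t₁ t₂ t₃)‖ ≤ C₀ ^ 2 * C₁ / δ ^ j := by
    intro t₁ h₁ t₂ h₂ t₃ h₃
    split_ifs with hc
    · rw [norm_zero]; positivity
    · simp only [hf, norm_mul]
      by_cases h21 : t₂ = t₁
      · have h31 : t₃ ≠ t₁ := fun h ↦ hc ⟨h21, h⟩
        calc ‖coefA w (t₁ - t₂)‖ * ‖coefA w (t₂ - t₃)‖ * ‖coefA w (t₃ - t₁)‖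
            ≤ C₀ * C₀ * (C₁ / δ ^ j) := by
              gcongr
              · exact hC₀ _
              · exact hC₀ _
              · exact hA t₃ h₃ t₁ h₁ h31
          _ = C₀ ^ 2 * C₁ / δ ^ j := by ring
      · have h12 : t₁ ≠ t₂ := fun h ↦ h21 h.symm
        calc ‖coefA w (t₁ - t₂)‖ * ‖coefA w (t₂ - t₃)‖ * ‖coefA w (t₃ - t₁)‖
            ≤ (C₁ / δ ^ j) * C₀ * C₀ := by
              gcongr
              · exact hA t₁ h₁ t₂ h₂ h12
              · exact hC₀ _
              · exact hC₀ _
          _ = C₀ ^ 2 * C₁ / δ ^ j := by ring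
  have h := norm_triple_sum_le hbound
  calc (N : ℝ) ^ 3 * ‖∑ t₁ ∈ W, ∑ t₂ ∈ W, ∑ t₃ ∈ W, (if t₂ = t₁ ∧ t₃ = t₁ then 0 else f t₁ t₂ t₃)‖
      ≤ (N : ℝ) ^ 3 * ((W.card : ℝ) ^ 3 * (C₀ ^ 2 * C₁ / δ ^ j)) := by gcongr
    _ = C₀ ^ 2 * C₁ * (N : ℝ) ^ 3 * (W.card : ℝ) ^ 3 / δ ^ j := by ring

/-- **Guth–Maynard Proposition 5.1 (`S₁` bound), quantitative form**: for a `δ`-separated `W` of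
diameter `≤ L` and `N ≥ 1`, `|S₁| ≪_j N³|W|³((1+L)²δ^{-j} + N^{-j})`: in each term of `S₁` either
`t₁ = t₂ = t₃`, and then the factor `B_N(0) = ∑_{m≠0} ĥ_0(mN)` is `≪_j N^{-j}` (eq. (5.3)), or one
of the two factors `A = ĥ_{t_a−t_b}(0)` has `t_a ≠ t_b` and is `≪_j δ^{-j}` (eq. (5.1)), the
remaining factors being `≪ 1` and `|B_N(τ)| ≪ (1+|τ|)² ≪ (1+L)²`. (In the paper's setting
`L = T`, `δ = T^ε`, this is `S₁ = O_ε(T^{-10})`.) [cite: GuthMaynard2026, Proposition 5.1] -/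
theorem norm_S1_le (hw : ContDiff ℝ ∞ w) (hsupp : Function.support w ⊆ Set.Icc 1 2) (j : ℕ) :
    ∃ C, 0 ≤ C ∧ ∀ (N : ℕ), 1 ≤ N → ∀ (W : Finset ℝ) (δ L : ℝ), 0 < δ → 0 ≤ L →
      (∀ t ∈ W, ∀ t' ∈ W, t ≠ t' → δ ≤ |t - t'|) → (∀ t ∈ W, ∀ t' ∈ W, |t - t'| ≤ L) →
      ‖S1 w N W‖ ≤ C * (N : ℝ) ^ 3 * (W.card : ℝ) ^ 3 * ((1 + L) ^ 2 / δ ^ j + 1 / (N : ℝ) ^ j) := by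
  obtain ⟨C₀, hC₀0, hC₀⟩ := norm_coefA_le hw hsupp
  obtain ⟨C₁, hC₁0, hC₁⟩ := norm_coefA_le_div hw hsupp j
  obtain ⟨C₂, hC₂0, hC₂⟩ := norm_coefB_le hw hsupp (le_refl 2)
  obtain ⟨C₃, hC₃0, hC₃⟩ := norm_coefB_le hw hsupp (j := max j 2) (le_max_right _ _)
  refine ⟨3 * (C₂ * C₀ * C₁ + C₃ * C₀ ^ 2), by positivity,
    fun N hN W δ L hδ hL hsep hdiam ↦ ?_⟩
  classical
  have hN1 : (1 : ℝ) ≤ N := by exact_mod_cast hN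
  have hN0 : (0 : ℝ) < N := by linarith
  -- the basic bounds
  have hA : ∀ t ∈ W, ∀ t' ∈ W, t ≠ t' → ‖coefA w (t - t')‖ ≤ C₁ / δ ^ j := by
    intro t ht t' ht' hne
    have hτ : t - t' ≠ 0 := sub_ne_zero.mpr hne
    refine (hC₁ _ hτ).trans ?_
    exact div_le_div_of_nonneg_left hC₁0 (pow_pos hδ j)
      (pow_le_pow_left₀ hδ.le (hsep t ht t' ht' hne) j)
  have hB : ∀ t ∈ W, ∀ t' ∈ W, ‖coefB w N (t - t')‖ ≤ C₂ * (1 + L) ^ 2 := by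
    intro t ht t' ht'
    refine (hC₂ (t - t') N hN1).trans ?_
    have h1 : (1 + |t - t'|) ^ 2 ≤ (1 + L) ^ 2 := by
      have := hdiam t ht t' ht'
      gcongr
    calc C₂ * (1 + |t - t'|) ^ 2 / (N : ℝ) ^ 2 ≤ C₂ * (1 + |t - t'|) ^ 2 / 1 :=
          div_le_div_of_nonneg_left (by positivity) one_pos (one_le_pow₀ hN1)
      _ ≤ C₂ * (1 + L) ^ 2 := by rw [div_one]; gcongr
  have hB0 : ‖coefB w N 0‖ ≤ C₃ / (N : ℝ) ^ j := by
    refine (hC₃ 0 N hN1).trans ?_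
    simp only [abs_zero, add_zero, one_pow, mul_one]
    exact div_le_div_of_nonneg_left hC₃0 (by positivity)
      (pow_le_pow_right₀ hN1 (le_max_left _ _))
  -- every term is bounded by `K`
  set K : ℝ := C₂ * (1 + L) ^ 2 * C₀ * (C₁ / δ ^ j) + C₃ / (N : ℝ) ^ j * C₀ * C₀ with hK
  have hK0 : 0 ≤ K := by positivity
  have hterm : ∀ t₁ ∈ W, ∀ t₂ ∈ W, ∀ t₃ ∈ W,
      ‖coefB w N (t₁ - t₂) * coefA w (t₂ - t₃) * coefA w (t₃ - t₁)‖ ≤ K ∧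
      ‖coefA w (t₁ - t₂) * coefB w N (t₂ - t₃) * coefA w (t₃ - t₁)‖ ≤ K ∧
      ‖coefA w (t₁ - t₂) * coefA w (t₂ - t₃) * coefB w N (t₃ - t₁)‖ ≤ K := by
    intro t₁ h₁ t₂ h₂ t₃ h₃
    have hKoff : C₂ * (1 + L) ^ 2 * C₀ * (C₁ / δ ^ j) ≤ K := by
      rw [hK]; have : 0 ≤ C₃ / (N : ℝ) ^ j * C₀ * C₀ := by positivity
      linarith
    have hKdiag : C₃ / (N : ℝ) ^ j * C₀ * C₀ ≤ K := by
      rw [hK]; have : 0 ≤ C₂ * (1 + L) ^ 2 * C₀ * (C₁ / δ ^ j) := by positivity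
      linarith
    by_cases hall : t₂ = t₁ ∧ t₃ = t₁
    · obtain ⟨rfl, rfl⟩ := hall
      simp only [sub_self, norm_mul]
      have hd : ‖coefB w N 0‖ * ‖coefA w 0‖ * ‖coefA w 0‖ ≤ K := by
        calc ‖coefB w N 0‖ * ‖coefA w 0‖ * ‖coefA w 0‖
            ≤ C₃ / (N : ℝ) ^ j * C₀ * C₀ :=
              mul_le_mul (mul_le_mul hB0 (hC₀ 0) (norm_nonneg _) (by positivity)) (hC₀ 0)
                (norm_nonneg _) (by positivity)
          _ ≤ K := hKdiag
      refine ⟨hd, ?_, ?_⟩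
      · calc ‖coefA w 0‖ * ‖coefB w N 0‖ * ‖coefA w 0‖
            = ‖coefB w N 0‖ * ‖coefA w 0‖ * ‖coefA w 0‖ := by ring
          _ ≤ K := hd
      · calc ‖coefA w 0‖ * ‖coefA w 0‖ * ‖coefB w N 0‖
            = ‖coefB w N 0‖ * ‖coefA w 0‖ * ‖coefA w 0‖ := by ring
          _ ≤ K := hd
    · simp only [norm_mul]
      -- at least one of the `A` factors with distinct arguments is small
      refine ⟨?_, ?_, ?_⟩
      · -- `A` at `t₂ - t₃` and `t₃ - t₁`
        by_cases h31 : t₃ = t₁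
        · have h23 : t₂ ≠ t₃ := fun h ↦ hall ⟨h.trans h31, h31⟩
          calc ‖coefB w N (t₁ - t₂)‖ * ‖coefA w (t₂ - t₃)‖ * ‖coefA w (t₃ - t₁)‖
              ≤ (C₂ * (1 + L) ^ 2) * (C₁ / δ ^ j) * C₀ := by
                gcongr
                · exact hB t₁ h₁ t₂ h₂
                · exact hA t₂ h₂ t₃ h₃ h23
                · exact hC₀ _
            _ = C₂ * (1 + L) ^ 2 * C₀ * (C₁ / δ ^ j) := by ring
            _ ≤ K := hKoff
        · calc ‖coefB w N (t₁ - t₂)‖ * ‖coefA w (t₂ - t₃)‖ * ‖coefA w (t₃ - t₁)‖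
              ≤ (C₂ * (1 + L) ^ 2) * C₀ * (C₁ / δ ^ j) := by
                gcongr
                · exact hB t₁ h₁ t₂ h₂
                · exact hC₀ _
                · exact hA t₃ h₃ t₁ h₁ h31
            _ ≤ K := hKoff
      · -- `A` at `t₁ - t₂` and `t₃ - t₁`
        by_cases h21 : t₂ = t₁
        · have h31 : t₃ ≠ t₁ := fun h ↦ hall ⟨h21, h⟩
          calc ‖coefA w (t₁ - t₂)‖ * ‖coefB w N (t₂ - t₃)‖ * ‖coefA w (t₃ - t₁)‖
              ≤ C₀ * (C₂ * (1 + L) ^ 2) * (C₁ / δ ^ j) := by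
                gcongr
                · exact hC₀ _
                · exact hB t₂ h₂ t₃ h₃
                · exact hA t₃ h₃ t₁ h₁ h31
            _ = C₂ * (1 + L) ^ 2 * C₀ * (C₁ / δ ^ j) := by ring
            _ ≤ K := hKoff
        · have h12 : t₁ ≠ t₂ := fun h ↦ h21 h.symm
          calc ‖coefA w (t₁ - t₂)‖ * ‖coefB w N (t₂ - t₃)‖ * ‖coefA w (t₃ - t₁)‖
              ≤ (C₁ / δ ^ j) * (C₂ * (1 + L) ^ 2) * C₀ := by
                gcongr
                · exact hA t₁ h₁ t₂ h₂ h12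
                · exact hB t₂ h₂ t₃ h₃
                · exact hC₀ _
            _ = C₂ * (1 + L) ^ 2 * C₀ * (C₁ / δ ^ j) := by ring
            _ ≤ K := hKoff
      · -- `A` at `t₁ - t₂` and `t₂ - t₃`
        by_cases h21 : t₂ = t₁
        · have h23 : t₂ ≠ t₃ := fun h ↦ hall ⟨h21, h.symm.trans h21⟩
          calc ‖coefA w (t₁ - t₂)‖ * ‖coefA w (t₂ - t₃)‖ * ‖coefB w N (t₃ - t₁)‖
              ≤ C₀ * (C₁ / δ ^ j) * (C₂ * (1 + L) ^ 2) := by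
                gcongr
                · exact hC₀ _
                · exact hA t₂ h₂ t₃ h₃ h23
                · exact hB t₃ h₃ t₁ h₁
            _ = C₂ * (1 + L) ^ 2 * C₀ * (C₁ / δ ^ j) := by ring
            _ ≤ K := hKoff
        · have h12 : t₁ ≠ t₂ := fun h ↦ h21 h.symm
          calc ‖coefA w (t₁ - t₂)‖ * ‖coefA w (t₂ - t₃)‖ * ‖coefB w N (t₃ - t₁)‖
              ≤ (C₁ / δ ^ j) * C₀ * (C₂ * (1 + L) ^ 2) := by
                gcongr
                · exact hA t₁ h₁ t₂ h₂ h12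
                · exact hC₀ _
                · exact hB t₃ h₃ t₁ h₁
            _ = C₂ * (1 + L) ^ 2 * C₀ * (C₁ / δ ^ j) := by ring
            _ ≤ K := hKoff
  have hsum : ‖∑ t₁ ∈ W, ∑ t₂ ∈ W, ∑ t₃ ∈ W,
      (coefB w N (t₁ - t₂) * coefA w (t₂ - t₃) * coefA w (t₃ - t₁) +
        coefA w (t₁ - t₂) * coefB w N (t₂ - t₃) * coefA w (t₃ - t₁) +
        coefA w (t₁ - t₂) * coefA w (t₂ - t₃) * coefB w N (t₃ - t₁))‖ ≤
      (W.card : ℝ) ^ 3 * (3 * K) := by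
    refine norm_triple_sum_le fun t₁ h₁ t₂ h₂ t₃ h₃ ↦ ?_
    obtain ⟨b1, b2, b3⟩ := hterm t₁ h₁ t₂ h₂ t₃ h₃
    calc _ ≤ ‖coefB w N (t₁ - t₂) * coefA w (t₂ - t₃) * coefA w (t₃ - t₁) +
          coefA w (t₁ - t₂) * coefB w N (t₂ - t₃) * coefA w (t₃ - t₁)‖ +
          ‖coefA w (t₁ - t₂) * coefA w (t₂ - t₃) * coefB w N (t₃ - t₁)‖ := norm_add_le _ _
      _ ≤ (‖coefB w N (t₁ - t₂) * coefA w (t₂ - t₃) * coefA w (t₃ - t₁)‖ +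
          ‖coefA w (t₁ - t₂) * coefB w N (t₂ - t₃) * coefA w (t₃ - t₁)‖) +
          ‖coefA w (t₁ - t₂) * coefA w (t₂ - t₃) * coefB w N (t₃ - t₁)‖ := by
            gcongr; exact norm_add_le _ _
      _ ≤ K + K + K := by gcongr
      _ = 3 * K := by ring
  rw [S1, norm_mul, norm_pow, Complex.norm_natCast]
  have hKle : K ≤ (C₂ * C₀ * C₁ + C₃ * C₀ ^ 2) * ((1 + L) ^ 2 / δ ^ j + 1 / (N : ℝ) ^ j) := by
    rw [hK]
    have h1 : C₂ * (1 + L) ^ 2 * C₀ * (C₁ / δ ^ j) = C₂ * C₀ * C₁ * ((1 + L) ^ 2 / δ ^ j) := by ring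
    have h2 : C₃ / (N : ℝ) ^ j * C₀ * C₀ = C₃ * C₀ ^ 2 * (1 / (N : ℝ) ^ j) := by ring
    rw [h1, h2]
    have : 0 ≤ (1 + L) ^ 2 / δ ^ j := by positivity
    have : 0 ≤ 1 / (N : ℝ) ^ j := by positivity
    nlinarith [mul_nonneg (mul_nonneg hC₂0 hC₀0) hC₁0, mul_nonneg hC₃0 (sq_nonneg C₀)]
  calc (N : ℝ) ^ 3 * ‖_‖ ≤ (N : ℝ) ^ 3 * ((W.card : ℝ) ^ 3 * (3 * K)) := by gcongr
    _ ≤ (N : ℝ) ^ 3 * ((W.card : ℝ) ^ 3 *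
        (3 * ((C₂ * C₀ * C₁ + C₃ * C₀ ^ 2) * ((1 + L) ^ 2 / δ ^ j + 1 / (N : ℝ) ^ j)))) := by
          gcongr
    _ = _ := by ring

end weight


/-! ## §9. Proposition 4.6: large values are controlled by `S₂ + S₃` -/

/-- The error budget of Proposition 4.6: `R := |S₀ − N³|W|ĥ_0(0)³| + |S₁| +
|W|N³|(‖w‖² + re B_N(0))³ − ‖w‖⁶|` (all three are negligible in the paper's setting,
`card_le_keyProp_setting`). [cite: GuthMaynard2026, Proposition 4.6 (proof)] -/
def errR (w : ℝ → ℝ) (N : ℕ) (W : Finset ℝ) : ℝ :=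
  ‖S0 w N W - (N : ℂ) ^ 3 * W.card * (coefA w 0) ^ 3‖ + ‖S1 w N W‖ +
    (W.card : ℝ) * (N : ℝ) ^ 3 *
      |((∫ u, (w u) ^ 2) + (coefB w N 0).re) ^ 3 - (∫ u, (w u) ^ 2) ^ 3|

/-- `errR ≥ 0`. [folklore] -/
theorem errR_nonneg (w : ℝ → ℝ) (N : ℕ) (W : Finset ℝ) : 0 ≤ errR w N W := by
  unfold errR; positivity

/-- `tr(G) = |W| ∑_n w(n/N)²`. [cite: GuthMaynard2026, proof of Lemma 4.4] -/
theorem trace_gram_eq_card_mul_sum (w : ℝ → ℝ) (N : ℕ) (W : Finset ℝ) :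
    (gram w N W).trace = (W.card : ℂ) *
      ∑ n ∈ Finset.Icc N (2 * N), (((w ((n : ℝ) / N)) ^ 2 : ℝ) : ℂ) := by
  unfold Matrix.trace gram
  simp only [Matrix.diag_apply, Matrix.of_apply, sub_self, Complex.ofReal_zero, zero_mul,
    Complex.cpow_zero, mul_one]
  rw [Finset.sum_const, Finset.card_univ, Fintype.card_coe, nsmul_eq_mul]

/-- `re tr(G) = |W| ∑_n w(n/N)²`. [cite: GuthMaynard2026, proof of Lemma 4.4] -/
theorem re_trace_gram (w : ℝ → ℝ) (N : ℕ) (W : Finset ℝ) :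
    (gram w N W).trace.re = (W.card : ℝ) * ∑ n ∈ Finset.Icc N (2 * N), (w ((n : ℝ) / N)) ^ 2 := by
  rw [trace_gram_eq_card_mul_sum, ← Complex.ofReal_sum]
  have : ((W.card : ℂ) * ((∑ n ∈ Finset.Icc N (2 * N), (w ((n : ℝ) / N)) ^ 2 : ℝ) : ℂ)) =
      (((W.card : ℝ) * ∑ n ∈ Finset.Icc N (2 * N), (w ((n : ℝ) / N)) ^ 2 : ℝ) : ℂ) := by
    push_cast; ring
  rw [this, Complex.ofReal_re]

section weight

variable {w : ℝ → ℝ}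

/-- `w²` is bounded. [folklore] -/
theorem exists_bound_sq (hw : ContDiff ℝ ∞ w) (hsupp : Function.support w ⊆ Set.Icc 1 2) :
    ∃ K, 0 ≤ K ∧ ∀ x, (w x) ^ 2 ≤ K := by
  obtain ⟨K, hK0, hK⟩ := exists_bound_iteratedDeriv (wSq_contDiff hw) isCompact_Icc
    (tsupport_wSq_subset hsupp) 0
  refine ⟨K, hK0, fun x ↦ ?_⟩
  have := hK x
  rw [iteratedDeriv_zero, wSq] at this
  rwa [Complex.norm_real, Real.norm_eq_abs, abs_of_nonneg (sq_nonneg (w x))] at this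

set_option maxHeartbeats 1000000 in
/-- **Guth–Maynard Proposition 4.6, general form.** For a smooth `w` supported in `[1,2]` there is
`C` such that for all `N ≥ 1`, `σ`, `1`-bounded `b_n` and finite `W ⊂ ℝ` with
`|∑_n w(n/N) b_n n^{it}| ≥ N^σ` on `W`,
`|W| ≤ C (N^{2−2σ} + N^{1−2σ} |S₂ + S₃|^{1/3} + N^{1−2σ} R^{1/3})`,
where `R = errR w N W` is the error budget (negligible in the paper's setting). Proof as in the
paper: Lemmas 4.1–4.2 (`GuthMaynardMatrix.card_mul_sq_le_traceBound`), Lemma 4.4 (`tr G`) and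
Lemma 4.5 (`tr G³ = S₀ + S₁ + S₂ + S₃`), "noting that the `N³|W|‖w‖⁶_{L²}` term cancels with
`tr(M_WM_W^*)³/|W|²`". [cite: GuthMaynard2026, Proposition 4.6] -/
theorem card_le_of_largeValues (hw : ContDiff ℝ ∞ w) (hsupp : Function.support w ⊆ Set.Icc 1 2) :
    ∃ C, 0 ≤ C ∧ ∀ (N : ℕ), 1 ≤ N → ∀ (σ : ℝ) (b : ℕ → ℂ) (W : Finset ℝ), (∀ n, ‖b n‖ ≤ 1) →
      (∀ t ∈ W, (N : ℝ) ^ σ ≤ ‖∑ n ∈ Finset.Icc N (2 * N),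
        ((w ((n : ℝ) / N) : ℝ) : ℂ) * b n * (n : ℂ) ^ ((t : ℂ) * I)‖) →
      (W.card : ℝ) ≤ C * ((N : ℝ) ^ (2 - 2 * σ) +
        (N : ℝ) ^ (1 - 2 * σ) * ‖S2 w N W + S3 w N W‖ ^ (1 / 3 : ℝ) +
        (N : ℝ) ^ (1 - 2 * σ) * (errR w N W) ^ (1 / 3 : ℝ)) := by
  obtain ⟨K, hK0, hK⟩ := exists_bound_sq hw hsupp
  refine ⟨16 + 32 * K, by positivity, fun N hN σ b W hb hlarge ↦ ?_⟩
  have hN1 : (1 : ℝ) ≤ N := by exact_mod_cast hN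
  have hN0 : (0 : ℝ) < N := by linarith
  rcases W.eq_empty_or_nonempty with hWe | hWne
  · subst hWe; simp only [Finset.card_empty, Nat.cast_zero]
    have := errR_nonneg w N ∅
    positivity
  have hW0 : (0 : ℝ) < W.card := by exact_mod_cast hWne.card_pos
  -- the quantities
  set G := gram w N W with hGdef
  set c : ℝ := ∫ u, (w u) ^ 2 with hc
  set β : ℝ := (coefB w N 0).re with hβ
  set S : ℝ := ‖S2 w N W + S3 w N W‖ with hS
  set R : ℝ := errR w N W with hR
  have hS0' : 0 ≤ S := norm_nonneg _
  have hR0 : 0 ≤ R := errR_nonneg w N W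
  set E : ℝ := (G ^ 3).trace.re - G.trace.re ^ 3 / (W.card : ℝ) ^ 2 with hE
  set M : ℝ := G.trace.re / W.card with hM
  -- Lemmas 4.1 and 4.2
  have hV : (0 : ℝ) < (N : ℝ) ^ σ := by positivity
  have h := GuthMaynardMatrix.card_mul_sq_le_traceBound hN (fun n ↦ w ((n : ℝ) / N)) hb W hV
    hlarge G rfl
  obtain ⟨hE0, hmain⟩ := h
  rw [← hE, ← hM] at hmain
  have hE0' : 0 ≤ E := by rw [hE]; exact hE0
  -- `M = ∑_n w(n/N)² ≤ (N+1) K`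
  have hMeq : M = ∑ n ∈ Finset.Icc N (2 * N), (w ((n : ℝ) / N)) ^ 2 := by
    rw [hM, hGdef, re_trace_gram]; field_simp
  have hM0 : 0 ≤ M := by rw [hMeq]; positivity
  have hMle : M ≤ ((N : ℝ) + 1) * K := by
    rw [hMeq]
    calc ∑ n ∈ Finset.Icc N (2 * N), (w ((n : ℝ) / N)) ^ 2 ≤ ∑ n ∈ Finset.Icc N (2 * N), K :=
          Finset.sum_le_sum fun n _ ↦ hK _
      _ = ((N : ℝ) + 1) * K := by
          rw [Finset.sum_const, Nat.card_Icc, nsmul_eq_mul]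
          have : 2 * N + 1 - N = N + 1 := by omega
          rw [this]; push_cast; ring
  -- `tr G = |W| N (c + β)` and `tr G³ = S₀ + S₁ + S₂ + S₃`
  have htr : G.trace.re = (W.card : ℝ) * ((N : ℝ) * (c + β)) := by
    rw [hGdef, trace_gram hw hsupp hN W, coefA_zero]
    have : ((W.card : ℂ) * ((N : ℂ) * ((c : ℂ) + coefB w N 0))) =
        (((W.card : ℝ) * N : ℝ) : ℂ) * ((c : ℂ) + coefB w N 0) := by push_cast; ring
    rw [this, Complex.re_ofReal_mul, Complex.add_re, Complex.ofReal_re, hβ]; ring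
  have htr3 : (G ^ 3).trace = S0 w N W + S1 w N W + S2 w N W + S3 w N W := by
    rw [hGdef]; exact trace_gram_pow_three hw hsupp hN W
  -- `E ≤ S + R`
  have hEle : E ≤ S + R := by
    have h1 : (G ^ 3).trace.re = (S0 w N W - (N : ℂ) ^ 3 * W.card * (coefA w 0) ^ 3).re +
        (N : ℝ) ^ 3 * W.card * c ^ 3 + (S1 w N W).re + (S2 w N W + S3 w N W).re := by
      rw [htr3, coefA_zero]
      simp only [Complex.add_re, Complex.sub_re]
      have : ((N : ℂ) ^ 3 * (W.card : ℂ) * ((c : ℂ)) ^ 3).re = (N : ℝ) ^ 3 * W.card * c ^ 3 := by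
        have : ((N : ℂ) ^ 3 * (W.card : ℂ) * ((c : ℂ)) ^ 3) = (((N : ℝ) ^ 3 * W.card * c ^ 3 : ℝ) : ℂ) := by
          push_cast; ring
        rw [this, Complex.ofReal_re]
      rw [this]; ring
    have h2 : G.trace.re ^ 3 / (W.card : ℝ) ^ 2 = (W.card : ℝ) * (N : ℝ) ^ 3 * (c + β) ^ 3 := by
      rw [htr]; field_simp
    rw [hE, h1, h2]
    have e1 := Complex.re_le_norm (S0 w N W - (N : ℂ) ^ 3 * W.card * (coefA w 0) ^ 3)
    have e2 := Complex.re_le_norm (S1 w N W)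
    have e3 := Complex.re_le_norm (S2 w N W + S3 w N W)
    have e4 : (N : ℝ) ^ 3 * W.card * c ^ 3 - (W.card : ℝ) * (N : ℝ) ^ 3 * (c + β) ^ 3 ≤
        (W.card : ℝ) * (N : ℝ) ^ 3 * |(c + β) ^ 3 - c ^ 3| := by
      have : (N : ℝ) ^ 3 * W.card * c ^ 3 - (W.card : ℝ) * (N : ℝ) ^ 3 * (c + β) ^ 3 =
          (W.card : ℝ) * (N : ℝ) ^ 3 * (-((c + β) ^ 3 - c ^ 3)) := by ring
      rw [this]
      gcongr
      exact neg_le_abs _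
    rw [hS, hR, errR]
    linarith
  -- the real inequalities
  have hsq : ((N : ℝ) ^ σ) ^ 2 = (N : ℝ) ^ (2 * σ) := by
    rw [← Real.rpow_natCast, ← Real.rpow_mul hN0.le]; ring_nf
  have hE13 : (E ^ (1 / 6 : ℝ)) ^ 2 = E ^ (1 / 3 : ℝ) := by
    rw [← Real.rpow_natCast, ← Real.rpow_mul hE0']; norm_num
  have hM12 : (M ^ (1 / 2 : ℝ)) ^ 2 = M := by
    rw [← Real.rpow_natCast, ← Real.rpow_mul hM0]; norm_num
  have hE3le : E ^ (1 / 3 : ℝ) ≤ S ^ (1 / 3 : ℝ) + R ^ (1 / 3 : ℝ) := by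
    calc E ^ (1 / 3 : ℝ) ≤ (S + R) ^ (1 / 3 : ℝ) :=
          Real.rpow_le_rpow hE0' hEle (by norm_num)
      _ ≤ S ^ (1 / 3 : ℝ) + R ^ (1 / 3 : ℝ) :=
          Real.rpow_add_le_add_rpow hS0' hR0 (by norm_num) (by norm_num)
  have hS3 : 0 ≤ S ^ (1 / 3 : ℝ) := by positivity
  have hR3 : 0 ≤ R ^ (1 / 3 : ℝ) := by positivity
  have hstep : (W.card : ℝ) * (N : ℝ) ^ (2 * σ) ≤
      16 * N * S ^ (1 / 3 : ℝ) + 16 * N * R ^ (1 / 3 : ℝ) + 32 * K * (N : ℝ) ^ 2 := by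
    rw [← hsq]
    refine hmain.trans ?_
    have h1 : (2 * E ^ (1 / 6 : ℝ) + 2 * M ^ (1 / 2 : ℝ)) ^ 2 ≤ 8 * E ^ (1 / 3 : ℝ) + 8 * M := by
      have : (2 * E ^ (1 / 6 : ℝ) + 2 * M ^ (1 / 2 : ℝ)) ^ 2 ≤
          8 * (E ^ (1 / 6 : ℝ)) ^ 2 + 8 * (M ^ (1 / 2 : ℝ)) ^ 2 := by
        nlinarith [sq_nonneg (E ^ (1 / 6 : ℝ) - M ^ (1 / 2 : ℝ))]
      rw [hE13, hM12] at this
      exact this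
    have hN1' : (N : ℝ) + 1 ≤ 2 * N := by linarith
    calc ((N : ℝ) + 1) * (2 * E ^ (1 / 6 : ℝ) + 2 * M ^ (1 / 2 : ℝ)) ^ 2
        ≤ ((N : ℝ) + 1) * (8 * E ^ (1 / 3 : ℝ) + 8 * M) := by gcongr
      _ ≤ ((N : ℝ) + 1) * (8 * (S ^ (1 / 3 : ℝ) + R ^ (1 / 3 : ℝ)) + 8 * (((N : ℝ) + 1) * K)) := by
          gcongr
      _ ≤ (2 * N) * (8 * (S ^ (1 / 3 : ℝ) + R ^ (1 / 3 : ℝ)) + 8 * ((2 * N) * K)) := by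
          gcongr
      _ = 16 * N * S ^ (1 / 3 : ℝ) + 16 * N * R ^ (1 / 3 : ℝ) + 32 * K * (N : ℝ) ^ 2 := by ring
  -- divide by `N^{2σ}`
  have hpow : (0 : ℝ) < (N : ℝ) ^ (2 * σ) := by positivity
  have h12σ : (N : ℝ) ^ (1 - 2 * σ) = N / (N : ℝ) ^ (2 * σ) := by
    rw [Real.rpow_sub hN0, Real.rpow_one]
  have h22σ : (N : ℝ) ^ (2 - 2 * σ) = (N : ℝ) ^ 2 / (N : ℝ) ^ (2 * σ) := by
    rw [Real.rpow_sub hN0, show (2 : ℝ) = (2 : ℕ) by norm_num, Real.rpow_natCast]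
  rw [h12σ, h22σ]
  rw [← le_div_iff₀ hpow] at hstep
  refine hstep.trans ?_
  rw [div_le_iff₀ hpow]
  have hK16 : (16 : ℝ) ≤ 16 + 32 * K := by linarith
  have hK32 : 32 * K ≤ 16 + 32 * K := by linarith
  have hrhs : (16 + 32 * K) * ((N : ℝ) ^ 2 / (N : ℝ) ^ (2 * σ) +
      N / (N : ℝ) ^ (2 * σ) * S ^ (1 / 3 : ℝ) + N / (N : ℝ) ^ (2 * σ) * R ^ (1 / 3 : ℝ)) *
      (N : ℝ) ^ (2 * σ) = (16 + 32 * K) * (N : ℝ) ^ 2 + (16 + 32 * K) * N * S ^ (1 / 3 : ℝ) +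
      (16 + 32 * K) * N * R ^ (1 / 3 : ℝ) := by
    field_simp
  rw [hrhs]
  have : 0 ≤ (N : ℝ) * S ^ (1 / 3 : ℝ) := by positivity
  have : 0 ≤ (N : ℝ) * R ^ (1 / 3 : ℝ) := by positivity
  nlinarith [sq_nonneg (N : ℝ)]

/-- `|(c+β)³ − c³| ≤ |β| (3c² + 3c|β| + β²)` for `c ≥ 0`. [folklore] -/
theorem abs_cube_sub_cube_le {c β : ℝ} (hc : 0 ≤ c) :
    |(c + β) ^ 3 - c ^ 3| ≤ |β| * (3 * c ^ 2 + 3 * c * |β| + β ^ 2) := by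
  have h : (c + β) ^ 3 - c ^ 3 = β * (3 * c ^ 2 + 3 * c * β + β ^ 2) := by ring
  rw [h, abs_mul]
  gcongr
  calc |3 * c ^ 2 + 3 * c * β + β ^ 2| ≤ |3 * c ^ 2 + 3 * c * β| + |β ^ 2| := abs_add_le _ _
    _ ≤ (|3 * c ^ 2| + |3 * c * β|) + |β ^ 2| := by gcongr; exact abs_add_le _ _
    _ = 3 * c ^ 2 + 3 * c * |β| + β ^ 2 := by
        rw [abs_of_nonneg (by positivity : (0 : ℝ) ≤ 3 * c ^ 2), abs_mul,
          abs_of_nonneg (by positivity : (0 : ℝ) ≤ 3 * c), abs_of_nonneg (sq_nonneg β)]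

set_option maxHeartbeats 1000000 in
/-- **Guth–Maynard Propositions 4.6 and 5.1 in the setting of Proposition 3.1.** Let `w` be smooth
and supported in `[1,2]`, `σ ∈ ℝ`, `ε > 0`. There is `C` such that for every `N ≥ 1`, every
`1`-bounded `b_n` and every finite `W` contained in an interval of length `T = N^{6/5}` and
`T^ε`-separated with `|∑_n w(n/N) b_n n^{it}| ≥ N^σ` on `W`,
`|W| ≤ C (N^{2−2σ} + N^{1−2σ} |S₂ + S₃|^{1/3})`:
Proposition 4.6 (`|W| ≪ N^{2−2σ} + N^{1−2σ}(∑_{m≠0} I_m)^{1/3}`, `∑_{m≠0} I_m = S₁ + S₂ + S₃`) with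
the negligible `S₁ = O_ε(T^{-10})` (Proposition 5.1) and the `O_ε(T^{-100})` errors of Lemmas 4.4–4.5
absorbed (`errR ≪ 1` here: `|W| ≤ T + 1`, `norm_S0_sub_le`, `norm_S1_le`, `norm_coefB_le` with
`j ≍ 1/ε`). What remains of Proposition 3.1 is to bound `S₂` (§6) and `S₃` (§§7–11).
[cite: GuthMaynard2026, Propositions 4.6 and 5.1] -/
theorem card_le_keyProp_setting (hw : ContDiff ℝ ∞ w) (hsupp : Function.support w ⊆ Set.Icc 1 2)
    (σ : ℝ) {ε : ℝ} (hε : 0 < ε) :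
    ∃ C, 0 ≤ C ∧ ∀ N : ℕ, 1 ≤ N → ∀ (b : ℕ → ℂ) (t₀ : ℝ) (W : Finset ℝ), (∀ n, ‖b n‖ ≤ 1) →
      (∀ t ∈ W, t₀ ≤ t ∧ t ≤ t₀ + (N : ℝ) ^ (6 / 5 : ℝ)) →
      (∀ t ∈ W, ∀ t' ∈ W, t ≠ t' → ((N : ℝ) ^ (6 / 5 : ℝ)) ^ ε ≤ |t - t'|) →
      (∀ t ∈ W, (N : ℝ) ^ σ ≤ ‖∑ n ∈ Finset.Icc N (2 * N),
        ((w ((n : ℝ) / N) : ℝ) : ℂ) * b n * (n : ℂ) ^ ((t : ℂ) * I)‖) →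
      (W.card : ℝ) ≤ C * ((N : ℝ) ^ (2 - 2 * σ) +
        (N : ℝ) ^ (1 - 2 * σ) * ‖S2 w N W + S3 w N W‖ ^ (1 / 3 : ℝ)) := by
  obtain ⟨C₁, hC₁0, hC₁⟩ := card_le_of_largeValues hw hsupp
  set j : ℕ := ⌈8 / ε⌉₊ + 8 with hj
  have hj8 : 8 ≤ j := by omega
  have hεj : 8 ≤ ε * j := by
    have h1 : 8 / ε ≤ ⌈8 / ε⌉₊ := Nat.le_ceil _
    have h2 : (⌈8 / ε⌉₊ : ℝ) ≤ j := by rw [hj]; push_cast; linarith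
    have : 8 / ε ≤ j := h1.trans h2
    rwa [div_le_iff₀' hε] at this
  obtain ⟨C₂, hC₂0, hC₂⟩ := norm_S0_sub_le hw hsupp j
  obtain ⟨C₃, hC₃0, hC₃⟩ := norm_S1_le hw hsupp j
  obtain ⟨C₄, hC₄0, hC₄⟩ := norm_coefB_le hw hsupp (j := 8) (by norm_num)
  set c : ℝ := ∫ u, (w u) ^ 2 with hc
  have hc0 : 0 ≤ c := integral_nonneg fun u ↦ sq_nonneg _
  set Q : ℝ := 3 * c ^ 2 + 3 * c * C₄ + C₄ ^ 2 with hQ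
  set R₀ : ℝ := 8 * C₂ + 40 * C₃ + 2 * C₄ * Q with hR₀
  have hR₀0 : 0 ≤ R₀ := by positivity
  refine ⟨C₁ * (1 + R₀ ^ (1 / 3 : ℝ)), by positivity, fun N hN b t₀ W hb hW hsep hlarge ↦ ?_⟩
  have hN1 : (1 : ℝ) ≤ N := by exact_mod_cast hN
  have hN0 : (0 : ℝ) < N := by linarith
  set n : ℝ := (N : ℝ) with hn
  set T : ℝ := n ^ (6 / 5 : ℝ) with hT
  have hT1 : 1 ≤ T := Real.one_le_rpow hN1 (by norm_num)
  have hT0 : 0 < T := by linarith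
  set δ : ℝ := T ^ ε with hδ
  have hδ1 : 1 ≤ δ := Real.one_le_rpow hT1 hε.le
  have hδ0 : 0 < δ := by linarith
  -- `|W| ≤ T + 1 ≤ 2T`
  have hcardW : (W.card : ℝ) ≤ 2 * T := by
    classical
    have hinj : Function.Injective (fun t : ℝ ↦ t - t₀) := sub_left_injective
    have hcard : (W.image (fun t ↦ t - t₀)).card = W.card := Finset.card_image_of_injective _ hinj
    have h1 := GuthMaynardReduction.card_le_of_one_sep hT0.le (W.image (fun t ↦ t - t₀)) ?_ ?_
    · rw [hcard] at h1; linarith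
    · intro t ht
      rw [Finset.mem_image] at ht
      obtain ⟨u, hu, rfl⟩ := ht
      have := hW u hu
      constructor <;> linarith [this.1, this.2]
    · intro t ht t' ht' hne
      rw [Finset.mem_image] at ht ht'
      obtain ⟨u, hu, rfl⟩ := ht
      obtain ⟨u', hu', rfl⟩ := ht'
      have hne' : u ≠ u' := fun h ↦ hne (by rw [h])
      have := hsep u hu u' hu' hne'
      rw [show u - t₀ - (u' - t₀) = u - u' by ring]
      exact hδ1.trans this
  have hdiam : ∀ t ∈ W, ∀ t' ∈ W, |t - t'| ≤ T := by
    intro t ht t' ht'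
    have h1 := hW t ht; have h2 := hW t' ht'
    rw [abs_sub_le_iff]; constructor <;> linarith [h1.1, h1.2, h2.1, h2.2]
  -- exponent bookkeeping (`n ≥ 1`)
  have hpow_le : ∀ a b : ℝ, a ≤ b → n ^ a ≤ n ^ b := fun a b hab ↦
    Real.rpow_le_rpow_of_exponent_le hN1 hab
  have hT3 : T ^ 3 = n ^ (18 / 5 : ℝ) := by
    rw [hT, ← Real.rpow_natCast, ← Real.rpow_mul hN0.le]; norm_num
  have hT2 : T ^ 2 = n ^ (12 / 5 : ℝ) := by
    rw [hT, ← Real.rpow_natCast, ← Real.rpow_mul hN0.le]; norm_num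
  have hn3 : n ^ 3 = n ^ (3 : ℝ) := by rw [← Real.rpow_natCast]; norm_num
  have hD : n ^ (48 / 5 : ℝ) ≤ δ ^ j := by
    rw [hδ, hT, ← Real.rpow_natCast, ← Real.rpow_mul hT0.le, ← Real.rpow_mul hN0.le]
    apply hpow_le
    nlinarith
  have hD0 : 0 < n ^ (48 / 5 : ℝ) := by positivity
  have h33 : n ^ 3 * T ^ 3 = n ^ (33 / 5 : ℝ) := by
    rw [hT3, hn3, ← Real.rpow_add hN0]; norm_num
  -- (a) the `S₀` error
  have ha : ‖S0 w N W - (N : ℂ) ^ 3 * W.card * (coefA w 0) ^ 3‖ ≤ 8 * C₂ := by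
    refine (hC₂ N W δ hδ0 hsep).trans ?_
    have h1 : C₂ * n ^ 3 * (W.card : ℝ) ^ 3 / δ ^ j ≤ C₂ * n ^ 3 * (2 * T) ^ 3 / n ^ (48 / 5 : ℝ) := by
      have : C₂ * n ^ 3 * (W.card : ℝ) ^ 3 ≤ C₂ * n ^ 3 * (2 * T) ^ 3 := by gcongr
      calc C₂ * n ^ 3 * (W.card : ℝ) ^ 3 / δ ^ j ≤ C₂ * n ^ 3 * (2 * T) ^ 3 / δ ^ j := by gcongr
        _ ≤ C₂ * n ^ 3 * (2 * T) ^ 3 / n ^ (48 / 5 : ℝ) :=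
            div_le_div_of_nonneg_left (by positivity) hD0 hD
    refine h1.trans ?_
    rw [mul_pow, show (2 : ℝ) ^ 3 = 8 by norm_num, div_le_iff₀ hD0]
    have h2 : n ^ (33 / 5 : ℝ) ≤ n ^ (48 / 5 : ℝ) := hpow_le _ _ (by norm_num)
    calc C₂ * n ^ 3 * (8 * T ^ 3) = 8 * C₂ * (n ^ 3 * T ^ 3) := by ring
      _ = 8 * C₂ * n ^ (33 / 5 : ℝ) := by rw [h33]
      _ ≤ 8 * C₂ * n ^ (48 / 5 : ℝ) := by gcongr
  -- (b) the `S₁` error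
  have hb' : ‖S1 w N W‖ ≤ 40 * C₃ := by
    refine (hC₃ N hN W δ T hδ0 hT0.le hsep hdiam).trans ?_
    have h1 : (1 + T) ^ 2 / δ ^ j ≤ 4 * T ^ 2 / n ^ (48 / 5 : ℝ) := by
      calc (1 + T) ^ 2 / δ ^ j ≤ (2 * T) ^ 2 / δ ^ j := by gcongr; linarith
        _ ≤ (2 * T) ^ 2 / n ^ (48 / 5 : ℝ) := div_le_div_of_nonneg_left (by positivity) hD0 hD
        _ = 4 * T ^ 2 / n ^ (48 / 5 : ℝ) := by ring
    have h2 : 1 / n ^ j ≤ 1 / n ^ (8 : ℕ) :=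
      div_le_div_of_nonneg_left zero_le_one (by positivity) (pow_le_pow_right₀ hN1 hj8)
    have h3 : n ^ 3 * (W.card : ℝ) ^ 3 ≤ 8 * n ^ (33 / 5 : ℝ) := by
      calc n ^ 3 * (W.card : ℝ) ^ 3 ≤ n ^ 3 * (2 * T) ^ 3 := by gcongr
        _ = 8 * (n ^ 3 * T ^ 3) := by ring
        _ = 8 * n ^ (33 / 5 : ℝ) := by rw [h33]
    have h4 : n ^ (33 / 5 : ℝ) * (4 * T ^ 2 / n ^ (48 / 5 : ℝ)) ≤ 4 := by
      rw [hT2, mul_div_assoc', div_le_iff₀ hD0, show n ^ (33 / 5 : ℝ) * (4 * n ^ (12 / 5 : ℝ)) =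
        4 * (n ^ (33 / 5 : ℝ) * n ^ (12 / 5 : ℝ)) by ring, ← Real.rpow_add hN0]
      exact mul_le_mul_of_nonneg_left (hpow_le _ _ (by norm_num)) (by norm_num)
    have h5 : n ^ (33 / 5 : ℝ) * (1 / n ^ (8 : ℕ)) ≤ 1 := by
      rw [← Real.rpow_natCast, mul_one_div, div_le_one (by positivity)]
      exact hpow_le _ _ (by norm_num)
    calc C₃ * n ^ 3 * (W.card : ℝ) ^ 3 * ((1 + T) ^ 2 / δ ^ j + 1 / n ^ j)
        = C₃ * (n ^ 3 * (W.card : ℝ) ^ 3) * ((1 + T) ^ 2 / δ ^ j + 1 / n ^ j) := by ring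
      _ ≤ C₃ * (8 * n ^ (33 / 5 : ℝ)) * (4 * T ^ 2 / n ^ (48 / 5 : ℝ) + 1 / n ^ (8 : ℕ)) := by
          gcongr
      _ = 8 * C₃ * (n ^ (33 / 5 : ℝ) * (4 * T ^ 2 / n ^ (48 / 5 : ℝ)) +
          n ^ (33 / 5 : ℝ) * (1 / n ^ (8 : ℕ))) := by ring
      _ ≤ 8 * C₃ * (4 + 1) := by gcongr
      _ = 40 * C₃ := by ring
  -- (c) the `tr(G)³` error
  have hβ : |(coefB w N 0).re| ≤ C₄ / n ^ (8 : ℕ) := by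
    refine (Complex.abs_re_le_norm _).trans ((hC₄ 0 n hN1).trans ?_)
    simp
  have hβ' : |(coefB w N 0).re| ≤ C₄ := by
    refine hβ.trans (div_le_self hC₄0 (one_le_pow₀ hN1))
  have hc' : (W.card : ℝ) * n ^ 3 * |(c + (coefB w N 0).re) ^ 3 - c ^ 3| ≤ 2 * C₄ * Q := by
    have h1 := abs_cube_sub_cube_le (β := (coefB w N 0).re) hc0
    have h2 : |(c + (coefB w N 0).re) ^ 3 - c ^ 3| ≤ C₄ / n ^ (8 : ℕ) * Q := by
      refine h1.trans ?_
      have hb2 : (coefB w N 0).re ^ 2 ≤ C₄ ^ 2 := by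
        rw [← sq_abs]; exact pow_le_pow_left₀ (abs_nonneg _) hβ' 2
      have hQ' : 3 * c ^ 2 + 3 * c * |(coefB w N 0).re| + (coefB w N 0).re ^ 2 ≤ Q := by
        rw [hQ]
        have : 3 * c * |(coefB w N 0).re| ≤ 3 * c * C₄ :=
          mul_le_mul_of_nonneg_left hβ' (by positivity)
        linarith
      exact mul_le_mul hβ hQ' (by positivity) (by positivity)
    have h3 : (W.card : ℝ) * n ^ 3 ≤ 2 * n ^ (8 : ℕ) := by
      calc (W.card : ℝ) * n ^ 3 ≤ 2 * T * n ^ 3 := by gcongr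
        _ = 2 * (n ^ (6 / 5 : ℝ) * n ^ (3 : ℝ)) := by rw [hT, hn3]; ring
        _ = 2 * n ^ (21 / 5 : ℝ) := by rw [← Real.rpow_add hN0]; norm_num
        _ ≤ 2 * n ^ ((8 : ℕ) : ℝ) :=
            mul_le_mul_of_nonneg_left (hpow_le _ _ (by norm_num)) (by norm_num)
        _ = 2 * n ^ (8 : ℕ) := by rw [Real.rpow_natCast]
    have hn8 : 0 < n ^ (8 : ℕ) := by positivity
    calc (W.card : ℝ) * n ^ 3 * |(c + (coefB w N 0).re) ^ 3 - c ^ 3|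
        ≤ (2 * n ^ (8 : ℕ)) * (C₄ / n ^ (8 : ℕ) * Q) := by gcongr
      _ = 2 * C₄ * Q := by field_simp
  -- so `R ≤ R₀`
  have hR : errR w N W ≤ R₀ := by
    rw [errR, hR₀]
    have := ha; have := hb'; have := hc'
    linarith
  -- conclude
  have hmain := hC₁ N hN σ b W hb hlarge
  have hR3 : (errR w N W) ^ (1 / 3 : ℝ) ≤ R₀ ^ (1 / 3 : ℝ) :=
    Real.rpow_le_rpow (errR_nonneg w N W) hR (by norm_num)
  have h12 : n ^ (1 - 2 * σ) ≤ n ^ (2 - 2 * σ) := hpow_le _ _ (by linarith)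
  set S : ℝ := ‖S2 w N W + S3 w N W‖ ^ (1 / 3 : ℝ) with hS
  have hS0 : 0 ≤ S := by positivity
  have hR₀3 : 0 ≤ R₀ ^ (1 / 3 : ℝ) := by positivity
  have hE3 : 0 ≤ (errR w N W) ^ (1 / 3 : ℝ) := Real.rpow_nonneg (errR_nonneg w N W) _
  calc (W.card : ℝ) ≤ C₁ * (n ^ (2 - 2 * σ) + n ^ (1 - 2 * σ) * S +
        n ^ (1 - 2 * σ) * (errR w N W) ^ (1 / 3 : ℝ)) := hmain
    _ ≤ C₁ * (n ^ (2 - 2 * σ) + n ^ (1 - 2 * σ) * S + n ^ (2 - 2 * σ) * R₀ ^ (1 / 3 : ℝ)) := by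
        gcongr
    _ ≤ C₁ * (1 + R₀ ^ (1 / 3 : ℝ)) * (n ^ (2 - 2 * σ) + n ^ (1 - 2 * σ) * S) := by
        have h1 : 0 ≤ n ^ (2 - 2 * σ) := by positivity
        have h2 : 0 ≤ n ^ (1 - 2 * σ) * S := by positivity
        nlinarith [mul_nonneg hC₁0 hR₀3, mul_nonneg (mul_nonneg hC₁0 hR₀3) h2]

end weight

end GuthMaynardFourier

end Literature.NumberTheory.LFunctions

end
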